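import Literature.Computability.AlgebraicComplexity.QuantumFunctionals
import HarnessLib

/-!
# Quantum functionals: proof of the normalisation `F^θ(⟨r⟩) = r`

Topic: `Literature/Computability/AlgebraicComplexity`; sibling proof file of `QuantumFunctionals.lean`
(definitions and named facts live there, this file only proves). Discharges the named fact
`ChristandlVranaZuiddam2023_unitTensor` (Christandl–Vrana–Zuiddam, *Universal points in the asymptotic
spectrum of tensors*, J. Amer. Math. Soc. 36 (2023) = arXiv:1709.07851v3, Thm. 3.19.1 = Ex. 3.18):
`F^θ(⟨r⟩) = r` for every `r ∈ ℕ` and every `θ` in the probability simplex on three points, where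
`F^θ = quantumFunctional θ` and `⟨r⟩ = unitTensor ℂ r`.

## The printed proof (CVZ Ex. 3.18) and its formal counterpart

In orthonormal local bases the marginals `Tr_{[3]∖S} |ψ⟩⟨ψ|` of `ψ = ⟨r⟩` are projectors of rank `r`,
so the entropy of the normalised spectrum is `log₂ r` for each `S`; hence
`E_θ(⟨r⟩) ≥ H_θ(⟨r⟩) = ∑_S θ(S) log₂ r = log₂ r`. The upper bound is the dimension bound
`H(ρ) ≤ log₂ rank ρ ≤ log₂ dim V_S`. Here:

* `reducedDensityⱼ_unitTensor` — `|⟨r⟩⟩⟨⟨r⟩|ⱼ = 1` (the identity on `ℂ^r`, a rank-`r` projector);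
  `tensorNormSq_unitTensor` — `⟨⟨r⟩|⟨r⟩⟩ = r`; `marginalSpectrumⱼ_unitTensor` — the normalised
  marginal spectra are uniform `(1/r, …, 1/r)` (eigenvalues of `1` lie in its spectrum `{1}`,
  `eigenvalues_eq_one_of_eq_one`);
* `quantumEntropy_unitTensor` — `H_θ(⟨r⟩) = (θ₁ + θ₂ + θ₃) log₂ r`;
  `logQuantumFunctional_unitTensor` — `E_θ(⟨r⟩) = log₂ r` (lower bound from the line above with
  `(A, B, C) = (1, 1, 1)`, upper bound `logQuantumFunctional_le` of the definitions file);
* `ChristandlVranaZuiddam2023_unitTensor_holds` — `F^θ(⟨r⟩) = 2^{log₂ r} = r` for `r ≥ 1`, and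
  `F^θ(⟨0⟩) = F^θ(0) = 0` for `r = 0` (`⟨0⟩` is the empty tensor).

Nothing here changes a statement; no new definitions.
-/

noncomputable section

open scoped BigOperators Matrix ComplexOrder

namespace Literature.Computability.AlgebraicComplexity

section UnitTensorProof

variable {ι κ μ : Type*} [Fintype ι] [Fintype κ] [Fintype μ]

omit [Fintype κ] in
/-- Entries of `|t⟩⟨t|₂`: `∑_{a,c} t_{abc} conj(t_{ab'c})`. [folklore] -/
theorem reducedDensity₂_apply (t : ι → κ → μ → ℂ) (b b' : κ) :
    reducedDensity₂ t b b' = ∑ a, ∑ c, t a b c * star (t a b' c) := by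
  simp [reducedDensity₂, flatten₂, Matrix.mul_apply, Fintype.sum_prod_type]

omit [Fintype μ] in
/-- Entries of `|t⟩⟨t|₃`: `∑_{a,b} t_{abc} conj(t_{abc'})`. [folklore] -/
theorem reducedDensity₃_apply (t : ι → κ → μ → ℂ) (c c' : μ) :
    reducedDensity₃ t c c' = ∑ a, ∑ b, t a b c * star (t a b c') := by
  simp [reducedDensity₃, flatten₃, Matrix.mul_apply, Fintype.sum_prod_type]

/-- All eigenvalues of the identity matrix, in any enumeration `Matrix.IsHermitian.eigenvalues`,
equal `1` (they lie in the spectrum `{1}` of `1` in the nontrivial algebra of `n × n` matrices).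
[folklore] -/
theorem eigenvalues_eq_one_of_eq_one {n : Type*} [Fintype n] [DecidableEq n] {A : Matrix n n ℂ}
    (hA : A.IsHermitian) (h : A = 1) (i : n) : hA.eigenvalues i = 1 := by
  haveI : Nonempty n := ⟨i⟩
  subst h
  have hi := hA.eigenvalues_mem_spectrum_real i
  rwa [spectrum.one_eq, Set.mem_singleton_iff] at hi

/-- The unit tensor has real (`0`/`1`) entries: `conj ⟨r⟩_{abc} = ⟨r⟩_{abc}`. [folklore] -/
theorem star_unitTensor_apply (r : ℕ) (a b c : Fin r) :
    star (unitTensor ℂ r a b c) = unitTensor ℂ r a b c := by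
  rw [unitTensor_apply]
  split_ifs <;> simp

/-- `⟨r⟩_{aaa} · conj x = δ_{a a'}` when `x` is one of `⟨r⟩_{a'aa}`, `⟨r⟩_{aa'a}`, `⟨r⟩_{aaa'}`: the
single surviving term of each of the three marginals of `⟨r⟩`. [folklore] -/
theorem unitTensor_diag_mul_star (r : ℕ) (a a' : Fin r) (x : ℂ) (hx : x = unitTensor ℂ r a' a a ∨
      x = unitTensor ℂ r a a' a ∨ x = unitTensor ℂ r a a a') :
    unitTensor ℂ r a a a * star x = (1 : Matrix (Fin r) (Fin r) ℂ) a a' := by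
  rw [unitTensor_diag, one_mul]
  by_cases h : a = a'
  · subst h
    simp only [or_self] at hx
    rw [hx, unitTensor_diag, star_one, Matrix.one_apply_eq]
  · rw [Matrix.one_apply_ne h]
    have hx0 : x = 0 := by
      rcases hx with rfl | rfl | rfl <;> rw [unitTensor_apply, if_neg] <;> rintro ⟨h₁, h₂⟩
      · exact h h₁.symm
      · exact h h₁
      · exact h h₂
    rw [hx0, star_zero]

/-- `|⟨r⟩⟩⟨⟨r⟩|₁ = 1`: the first marginal of the unit tensor is the identity on `ℂ^r` (a rank-`r`
projector, CVZ Ex. 3.18). [cite: ChristandlVranaZuiddam2023, Ex. 3.18] -/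
theorem reducedDensity₁_unitTensor (r : ℕ) : reducedDensity₁ (unitTensor ℂ r) = 1 := by
  ext a a'
  rw [reducedDensity₁_apply,
    Finset.sum_eq_single_of_mem a (Finset.mem_univ a) fun b _ hb => Finset.sum_eq_zero fun c _ => by
      rw [unitTensor_apply (K := ℂ) r a b c, if_neg (fun h => hb h.1.symm), zero_mul],
    Finset.sum_eq_single_of_mem a (Finset.mem_univ a) fun c _ hc => by
      rw [unitTensor_apply (K := ℂ) r a a c, if_neg (fun h => hc h.2.symm), zero_mul]]
  exact unitTensor_diag_mul_star r a a' _ (Or.inl rfl)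

/-- `|⟨r⟩⟩⟨⟨r⟩|₂ = 1`. [cite: ChristandlVranaZuiddam2023, Ex. 3.18] -/
theorem reducedDensity₂_unitTensor (r : ℕ) : reducedDensity₂ (unitTensor ℂ r) = 1 := by
  ext b b'
  rw [reducedDensity₂_apply,
    Finset.sum_eq_single_of_mem b (Finset.mem_univ b) fun a _ ha => Finset.sum_eq_zero fun c _ => by
      rw [unitTensor_apply (K := ℂ) r a b c, if_neg (fun h => ha h.1), zero_mul],
    Finset.sum_eq_single_of_mem b (Finset.mem_univ b) fun c _ hc => by
      rw [unitTensor_apply (K := ℂ) r b b c, if_neg (fun h => hc h.2.symm), zero_mul]]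
  exact unitTensor_diag_mul_star r b b' _ (Or.inr (Or.inl rfl))

/-- `|⟨r⟩⟩⟨⟨r⟩|₃ = 1`. [cite: ChristandlVranaZuiddam2023, Ex. 3.18] -/
theorem reducedDensity₃_unitTensor (r : ℕ) : reducedDensity₃ (unitTensor ℂ r) = 1 := by
  ext c c'
  rw [reducedDensity₃_apply,
    Finset.sum_eq_single_of_mem c (Finset.mem_univ c) fun a _ ha => Finset.sum_eq_zero fun b _ => by
      rw [unitTensor_apply (K := ℂ) r a b c, if_neg (fun h => ha (h.1.trans h.2)), zero_mul],
    Finset.sum_eq_single_of_mem c (Finset.mem_univ c) fun b _ hb => by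
      rw [unitTensor_apply (K := ℂ) r c b c, if_neg (fun h => hb h.1.symm), zero_mul]]
  exact unitTensor_diag_mul_star r c c' _ (Or.inr (Or.inr rfl))

/-- `⟨⟨r⟩|⟨r⟩⟩ = r` (the trace of the identity marginal). [cite: ChristandlVranaZuiddam2023, Ex. 3.18] -/
theorem tensorNormSq_unitTensor (r : ℕ) : tensorNormSq (unitTensor ℂ r) = r := by
  have h := trace_reducedDensity₁ (unitTensor ℂ r)
  rw [reducedDensity₁_unitTensor, Matrix.trace_one, Fintype.card_fin] at h
  exact_mod_cast h.symm

/-- The normalised marginal spectra of `⟨r⟩` are uniform: `r₁(⟨r⟩) = (1/r, …, 1/r)`.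
[cite: ChristandlVranaZuiddam2023, Ex. 3.18] -/
theorem marginalSpectrum₁_unitTensor (r : ℕ) (i : Fin r) :
    marginalSpectrum₁ (unitTensor ℂ r) i = (r : ℝ)⁻¹ := by
  simp only [marginalSpectrum₁]
  rw [eigenvalues_eq_one_of_eq_one (isHermitian_reducedDensity₁ (unitTensor ℂ r))
    (reducedDensity₁_unitTensor r) i, tensorNormSq_unitTensor, one_div]

/-- `r₂(⟨r⟩) = (1/r, …, 1/r)`. [cite: ChristandlVranaZuiddam2023, Ex. 3.18] -/
theorem marginalSpectrum₂_unitTensor (r : ℕ) (i : Fin r) :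
    marginalSpectrum₂ (unitTensor ℂ r) i = (r : ℝ)⁻¹ := by
  simp only [marginalSpectrum₂]
  rw [eigenvalues_eq_one_of_eq_one (isHermitian_reducedDensity₂ (unitTensor ℂ r))
    (reducedDensity₂_unitTensor r) i, tensorNormSq_unitTensor, one_div]

/-- `r₃(⟨r⟩) = (1/r, …, 1/r)`. [cite: ChristandlVranaZuiddam2023, Ex. 3.18] -/
theorem marginalSpectrum₃_unitTensor (r : ℕ) (i : Fin r) :
    marginalSpectrum₃ (unitTensor ℂ r) i = (r : ℝ)⁻¹ := by
  simp only [marginalSpectrum₃]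
  rw [eigenvalues_eq_one_of_eq_one (isHermitian_reducedDensity₃ (unitTensor ℂ r))
    (reducedDensity₃_unitTensor r) i, tensorNormSq_unitTensor, one_div]

/-- The Shannon entropy of the uniform distribution on `r ≥ 1` points is `log₂ r`. [folklore] -/
theorem shannonEntropy_eq_of_forall_eq_inv {r : ℕ} (hr : 0 < r) {P : Fin r → ℝ}
    (hP : ∀ i, P i = (r : ℝ)⁻¹) : shannonEntropy P = Real.log r / Real.log 2 := by
  obtain rfl : P = fun _ => (r : ℝ)⁻¹ := funext hP
  have hr' : (r : ℝ) ≠ 0 := by exact_mod_cast hr.ne'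
  rw [shannonEntropy_def, Finset.sum_const, Finset.card_univ, Fintype.card_fin, nsmul_eq_mul,
    Real.negMulLog, Real.log_inv, neg_mul_neg, ← mul_assoc, mul_inv_cancel₀ hr', one_mul]

/-- `H_θ(⟨r⟩) = (θ(1) + θ(2) + θ(3)) log₂ r` for `r ≥ 1` (CVZ Ex. 3.18, the lower bound).
[cite: ChristandlVranaZuiddam2023, Ex. 3.18] -/
theorem quantumEntropy_unitTensor (θ : Fin 3 → ℝ) {r : ℕ} (hr : 0 < r) :
    quantumEntropy θ (unitTensor ℂ r) = (θ 0 + θ 1 + θ 2) * (Real.log r / Real.log 2) := by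
  rw [quantumEntropy, shannonEntropy_eq_of_forall_eq_inv hr (marginalSpectrum₁_unitTensor r),
    shannonEntropy_eq_of_forall_eq_inv hr (marginalSpectrum₂_unitTensor r),
    shannonEntropy_eq_of_forall_eq_inv hr (marginalSpectrum₃_unitTensor r)]
  ring

/-- `E_θ(⟨r⟩) = log₂ r` for `r ≥ 1` and `θ ∈ P([3])` (CVZ Ex. 3.18: lower bound `H_θ(⟨r⟩) = log₂ r`
at `(A, B, C) = (1, 1, 1)`, upper bound the dimension bound `logQuantumFunctional_le`).
[cite: ChristandlVranaZuiddam2023, Ex. 3.18] -/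
theorem logQuantumFunctional_unitTensor {θ : Fin 3 → ℝ} (hθ : θ ∈ stdSimplex ℝ (Fin 3)) {r : ℕ}
    (hr : 0 < r) : logQuantumFunctional θ (unitTensor ℂ r) = Real.log r / Real.log 2 := by
  have hsum : θ 0 + θ 1 + θ 2 = 1 := by
    have h := hθ.2
    rwa [Fin.sum_univ_three] at h
  apply le_antisymm
  · refine (logQuantumFunctional_le hθ.1 _).trans (le_of_eq ?_)
    rw [Fintype.card_fin]
    calc θ 0 * (Real.log r / Real.log 2) + θ 1 * (Real.log r / Real.log 2) +
          θ 2 * (Real.log r / Real.log 2)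
        = (θ 0 + θ 1 + θ 2) * (Real.log r / Real.log 2) := by ring
      _ = Real.log r / Real.log 2 := by rw [hsum, one_mul]
  · refine (le_of_eq ?_).trans (quantumEntropy_le_logQuantumFunctional hθ.1 _)
    rw [quantumEntropy_unitTensor θ hr, hsum, one_mul]

/-- `⟨r⟩ ≠ 0` for `r ≥ 1` (its entry at `(0,0,0)` is `1`). [folklore] -/
theorem unitTensor_ne_zero {r : ℕ} (hr : 0 < r) : unitTensor ℂ r ≠ 0 := by
  intro h
  have h' := congr_fun (congr_fun (congr_fun h ⟨0, hr⟩) ⟨0, hr⟩) ⟨0, hr⟩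
  simp at h'

/-- **CVZ Thm. 3.19.1 (= Ex. 3.18), proved**: `F^θ(⟨r⟩) = r` for every `r ∈ ℕ` and `θ ∈ P([3])`.
For `r = 0` both sides vanish (`⟨0⟩ = 0` is the empty tensor and `F^θ(0) = 0`); for `r ≥ 1`,
`F^θ(⟨r⟩) = 2^{E_θ(⟨r⟩)} = 2^{log₂ r} = r` by `logQuantumFunctional_unitTensor`.
[cite: ChristandlVranaZuiddam2023, Thm. 3.19.1] -/
theorem ChristandlVranaZuiddam2023_unitTensor_holds : ChristandlVranaZuiddam2023_unitTensor := by
  intro θ hθ r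
  rcases Nat.eq_zero_or_pos r with rfl | hr
  · have h0 : unitTensor ℂ 0 = 0 := funext fun a => Fin.elim0 a
    rw [h0, quantumFunctional_zero, Nat.cast_zero]
  · have hr' : (0 : ℝ) < r := by exact_mod_cast hr
    rw [quantumFunctional_of_ne_zero θ (unitTensor_ne_zero hr), logQuantumFunctional_unitTensor hθ hr,
      Real.rpow_def_of_pos two_pos, mul_div_cancel₀ _ (Real.log_pos one_lt_two).ne', Real.exp_log hr']

end UnitTensorProof

end Literature.Computability.AlgebraicComplexity

end
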